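import Summits.PneNP.PneNP.Theorems.SymmetryBudgetNoHiddenOrderPerPathCGReplayAdm

/-!
# `NoHiddenOrder` (stmt-PneNP-14781): the label budget RELATIVE TO THE START BLOCK (process on `Fin m`, start block the window)

Route `PneNP/SymmetryBudget`; continues `…PerPathCGBudget.lean` / `…PerPathCGAdm.lean` / `…PerPathCGReplayAdm.lean`.  There the label
budget along the solution subtree of the certified-label scheme over the components-only Corneil–Goldberg process is stated in terms of
`|V|` (`BudgetBound`, `AdmB (4|V| + ⌊log₂|V|⌋)`), which is what a compiler instantiating the vertex type with the window TYPE `↥W` needs.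
A compiler that runs the process on ALL of `Fin m` from the start block `W` (membership wires) needs the same budget in terms of `|W|` —
otherwise the label set is not polynomial in `m`.  Nothing in the mathematics depends on `|V|`: the log-BranchSum bound is really
`4·|W₀| + ⌊log₂|W₀|⌋` for the FIRST block `W₀` of the refinement path (`RefinementPath.sum_log_d_le_card0`, the same telescoping), a
timed path of a pointer lives inside the pointer's start atom (`length_le_card_fst`, `sum_log_smallestCell_le_card`), and the start atoms
lie inside the start block.  Hence:

* `BudgetBoundIn n₀ X λ` — `BudgetBound` with `n₀` in place of `|V|`; `reach_budgetBoundIn`: along the solution subtree (selector `cgSel`,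
  values the heights, equitable start `I₀`) every label satisfies `BudgetBoundIn |I₀.block| X λ` (from the timed-path data `InvData` of an
  unnamed vertex, which `reach_budget` already provides);
* `admB_of_reach_card`: hence `AdmB (4|I₀.block| + ⌊log₂|I₀.block|⌋) X λ`, and the root theorems with this admissibility for any valuation
  and any decoding right on the solution subtree (`cg_root_good_dec_admB_card`), for the generic replay (`cg_root_good_replay_admB_card`,
  `…_refineIn`), and the "every group of the solution subtree is valued" form (`cg_val_ne_none_of_reach_replay_admB_card`).
Sorry-free; supports stmt-PneNP-14781, does not close it.
-/

set_option linter.dupNamespace false -- `Summit.PneNP.PneNP.…` (D-0017 single-conjunct layout)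

namespace Summit.PneNP.PneNP.Theorems

open Finset

namespace BranchSum

variable {V : Type*} [DecidableEq V] {G : SimpleGraph V} [DecidableRel G.Adj]

/-! ### log-BranchSum relative to the first block -/

/-- **log-BranchSum relative to the first block**: along a refinement path `Σ_{k<N} ⌊log₂ d_k⌋ ≤ 4·|W 0| + ⌊log₂|W 0|⌋` (the telescoping
of `sum_log_d_le` never leaves `W 0`). -/
theorem RefinementPath.sum_log_d_le_card0 {N : ℕ} (R : RefinementPath G N) :
    ∑ k ∈ range N, Nat.log 2 (R.d k) ≤ 4 * (R.W 0).card + Nat.log 2 (R.W 0).card := by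
  rcases Nat.eq_zero_or_pos N with hN | hN
  · subst hN; simp
  · obtain ⟨M, rfl⟩ : ∃ M, N = M + 1 := ⟨N - 1, by omega⟩
    rw [sum_range_succ']
    have h1 := R.sum_log_d_succ_le (n := M) le_rfl
    have h4 := R.add_card_W_le (j := M + 1) le_rfl
    have h4' := R.add_card_W_le (j := M) (Nat.le_succ M)
    have h2 : R.Phi M ≤ (R.W M).card := R.Phi_le_card M
    have h5 : Nat.log 2 (R.d 0) ≤ Nat.log 2 (R.W 0).card := by
      obtain ⟨x, hx, -⟩ := R.exists_removed (k := 0) (by omega)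
      exact Nat.log_mono_right ((R.d_le 0 x hx).trans (card_le_card fun y hy => (mem_cellOf_iff.1 hy).1))
    omega

/-- The same for transition data. -/
theorem TransitionData.sum_log_d_le_card0 {N : ℕ} (T : TransitionData G N) :
    ∑ k ∈ range N, Nat.log 2 (T.d k) ≤ 4 * (T.W 0).card + Nat.log 2 (T.W 0).card :=
  T.toRefinementPath.sum_log_d_le_card0

/-- The same for the OR-steps of the real process. -/
theorem ORSteps.sum_log_d_le_card0 {N : ℕ} (P : ORSteps G N) :
    ∑ k ∈ range N, Nat.log 2 (P.d k) ≤ 4 * (P.W 0).card + Nat.log 2 (P.W 0).card :=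
  P.toTransitionData.sum_log_d_le_card0

/-- Monotonicity of the budget function `n ↦ 4n + ⌊log₂ n⌋`. -/
theorem budget_mono {a b : ℕ} (h : a ≤ b) : 4 * a + Nat.log 2 a ≤ 4 * b + Nat.log 2 b :=
  Nat.add_le_add (Nat.mul_le_mul_left 4 h) (Nat.log_mono_right h)

/-! ### A timed path lives inside its start block -/

section Timed

variable {v : V} {St : Finset V × (V → ℕ)} {x : ℕ → V} {t : ℕ}

/-- **A timed path has at most `|St.1|` OR-choices**: they are distinct vertices of the start block. -/
theorem length_le_card_fst (hOR : IsORChoice G v St x t) (hv : ∀ k, k < t → x k ≠ v) : t ≤ St.1.card := by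
  have hinj : Set.InjOn x ↑(range t) := fun i hi j hj hij =>
    x_injective hOR hv (mem_range.1 (mem_coe.1 hi)) (mem_range.1 (mem_coe.1 hj)) hij
  have hsub : (range t).image x ⊆ St.1 := by
    intro y hy
    obtain ⟨k, hk, rfl⟩ := mem_image.1 hy
    have hk' := mem_range.1 hk
    exact timed_fst_subset_of_le (G := G) (v := v) (St := St) (x := x) (Nat.zero_le k) (smallestCell_subset _ _ (hOR k hk').2)
  have := card_le_card hsub
  rwa [card_image_of_injOn hinj, card_range] at this

/-- **Linear per-path bound relative to the start block**: `Σ_{k<t} ⌊log₂ |smallestCell_k|⌋ ≤ 4|St.1| + ⌊log₂|St.1|⌋`. -/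
theorem sum_log_smallestCell_le_card [Fintype V] (hOR : IsORChoice G v St x t) (hv : ∀ k, k < t → x k ≠ v) (hvSt : v ∈ St.1)
    (heq0 : ∀ u ∈ St.1, ∀ w ∈ St.1, St.2 u = St.2 w → ∀ y ∈ St.1,
      ((cellOf St.1 St.2 y).filter fun z => G.Adj u z).card = ((cellOf St.1 St.2 y).filter fun z => G.Adj w z).card)
    (hconn0 : ∀ S ⊆ St.1, S.Nonempty → S ≠ St.1 → ∃ a ∈ S, ∃ b ∈ St.1 \ S, (swGraph G St.1 St.2).Adj a b) :
    ∑ k ∈ range t, Nat.log 2 (smallestCell (timed G v St x k).1 (timed G v St x k).2).card ≤ 4 * St.1.card + Nat.log 2 St.1.card := by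
  have h := (toORSteps G hOR hv hvSt heq0 hconn0).sum_log_d_le_card0
  have hW : ((toORSteps G hOR hv hvSt heq0 hconn0).W 0).card ≤ St.1.card := by
    show (if 0 < t then (timed G v St x 0).1 else ∅).card ≤ St.1.card
    split_ifs
    · exact le_rfl
    · simp
  exact h.trans (budget_mono hW)

end Timed

/-! ### The relative label budget along the solution subtree -/

/-- **The LABEL BUDGET relative to a size `n₀`**: `BudgetBound` with `n₀` in place of `|V|`. -/
def BudgetBoundIn (n₀ : ℕ) (X : Finset V) (lam : V → ℕ) : Prop :=
  ∃ (t : ℕ) (x : ℕ → V) (d : ℕ → ℕ), t ≤ n₀ ∧ Set.InjOn x ↑(range t) ∧ X = (range t).image x ∧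
    (∀ k, k < t → lam (x k) + 1 ≤ d k) ∧
    ∑ k ∈ range t, Nat.log 2 (d k) ≤ 4 * n₀ + Nat.log 2 n₀ ∧
    ∀ y, y ∉ X → lam y = 0

variable [Fintype V] {I₀ : CGInst V}

/-- **The timed-path data of an unnamed pointer give the relative budget** (`n₀ = |I₀.block|`): the OR-choices are at most `|atom| ≤ |I₀.block|`
many and their smallest cells obey the relative per-path bound. -/
theorem budgetBoundIn_of_invData
    (hI₀ : ∀ u ∈ I₀.1.1, ∀ u' ∈ I₀.1.1, I₀.1.2 u = I₀.1.2 u' → ∀ w ∈ I₀.1.1,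
      ((cellOf I₀.1.1 I₀.1.2 w).filter fun y => G.Adj u y).card = ((cellOf I₀.1.1 I₀.1.2 w).filter fun y => G.Adj u' y).card)
    {I : CGInst V} {X : Finset V} {lam : V → ℕ} {y : V} (hyI₀ : y ∈ I₀.1.1) (hInv : InvData G I₀ I X lam y)
    (h0 : ∀ y', y' ∉ X → lam y' = 0) : BudgetBoundIn I₀.1.1.card X lam := by
  obtain ⟨t, x, hORc, hxv, -, -, hX, hlam⟩ := hInv
  have hvSt : y ∈ (St G I₀ y).1 := self_mem_atom _ hyI₀
  have heq0 : ∀ u ∈ (St G I₀ y).1, ∀ u' ∈ (St G I₀ y).1, (St G I₀ y).2 u = (St G I₀ y).2 u' → ∀ w ∈ (St G I₀ y).1,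
      ((cellOf (St G I₀ y).1 (St G I₀ y).2 w).filter fun z => G.Adj u z).card =
        ((cellOf (St G I₀ y).1 (St G I₀ y).2 w).filter fun z => G.Adj u' z).card :=
    fun u hu u' hu' hc w hw => equitableIn_atom y hI₀ hu hu' hc hw
  have hconn0 : ∀ S ⊆ (St G I₀ y).1, S.Nonempty → S ≠ (St G I₀ y).1 →
      ∃ a ∈ S, ∃ b ∈ (St G I₀ y).1 \ S, (swGraph G (St G I₀ y).1 (St G I₀ y).2).Adj a b :=
    fun S hS hSne hSA => atom_connected I₀.1.2 hyI₀ hS hSne hSA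
  have hsub : (St G I₀ y).1.card ≤ I₀.1.1.card := card_le_card (atom_subset _ _ _)
  refine ⟨t, x, fun k => (smallestCell (timed G y (St G I₀ y) x k).1 (timed G y (St G I₀ y) x k).2).card,
    (length_le_card_fst hORc hxv).trans hsub, fun i hi j hj hij => ?_, hX, hlam,
    (sum_log_smallestCell_le_card hORc hxv hvSt heq0 hconn0).trans (budget_mono hsub), h0⟩
  exact x_injective hORc hxv (mem_range.1 (mem_coe.1 hi)) (mem_range.1 (mem_coe.1 hj)) hij

/-- **The relative label budget along the solution subtree**: every label `(block, X, λ)` reached from an equitable start `I₀` (selector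
`cgSel`, values the heights) satisfies `BudgetBoundIn |I₀.block| X λ`. -/
theorem reach_budgetBoundIn
    (hI₀ : ∀ u ∈ I₀.1.1, ∀ u' ∈ I₀.1.1, I₀.1.2 u = I₀.1.2 u' → ∀ w ∈ I₀.1.1,
      ((cellOf I₀.1.1 I₀.1.2 w).filter fun y => G.Adj u y).card = ((cellOf I₀.1.1 I₀.1.2 w).filter fun y => G.Adj u' y).card)
    {I : (cgProcess G).Inst} {X : Finset V} {lam : V → ℕ}
    (h : CertifiedLabels.Reach (cgProcess G) (cgSel (V := V)) (hgt G cgSel) I₀ I X lam) : BudgetBoundIn I₀.1.1.card X lam := by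
  induction h with
  | root =>
    exact ⟨0, fun _ => I₀.2.choose, fun _ => 0, Nat.zero_le _, by simp, by simp, fun k hk => absurd hk (Nat.not_lt_zero k), by simp,
      fun _ _ => rfl⟩
  | part _ _ _ ih => exact ih
  | @child I X lam A ch hR hs _ =>
    change CGInst V at I
    have hx : cgSel I ∈ A := cgSel_mem I _ _ hs
    obtain ⟨-, hOR, rfl, rfl⟩ := cgStep_eq_orNode_iff.1 hs
    -- a second vertex of the smallest cell: unnamed, still in the block of the child
    obtain ⟨y, hyC, hyx⟩ := exists_mem_ne hOR.2 (cgSel I)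
    have hyA : y ∈ I.1.1 := smallestCell_subset _ _ hyC
    have hyX : y ∉ X := fun hyX => by
      have hs1 := singleton_named_of_reach cgSel_mem hR y hyX hyA
      have : (smallestCell I.1.1 I.1.2).card = 1 := by rw [smallestCell_eq_cellOf _ hyC, hs1, card_singleton]
      omega
    have hyX' : y ∉ insert (cgSel I) X := by rw [mem_insert, not_or]; exact ⟨hyx, hyX⟩
    have hR' := CertifiedLabels.Reach.child hR hs
    obtain ⟨hBB, hInv⟩ := reach_budget hI₀ hR'
    obtain ⟨_, _, _, _, _, _, _, _, h0⟩ := hBB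
    exact budgetBoundIn_of_invData hI₀ (block_subset_of_reach hR hyA) (hInv y hyA hyX') h0

/-! ### Admissibility relative to the start block, and the root theorems -/

/-- **Relative budgeted labels are admissible** for `B := 4 n₀ + ⌊log₂ n₀⌋`. -/
theorem admB_of_budgetBoundIn {n₀ : ℕ} {X : Finset V} {lam : V → ℕ} (h : BudgetBoundIn n₀ X lam) :
    AdmB (4 * n₀ + Nat.log 2 n₀) X lam := by
  obtain ⟨t, x, d, -, hinj, hX, hlam, hsum, h0⟩ := h
  refine ⟨h0, ?_⟩
  rw [sum_log_eq_sum_prof]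
  exact sum_prof_le hinj hX hlam hsum

/-- **Along the solution subtree every label is admissible at the WINDOW budget `4|I₀.block| + ⌊log₂|I₀.block|⌋`.** -/
theorem admB_of_reach_card
    (hI₀ : ∀ u ∈ I₀.1.1, ∀ u' ∈ I₀.1.1, I₀.1.2 u = I₀.1.2 u' → ∀ w ∈ I₀.1.1,
      ((cellOf I₀.1.1 I₀.1.2 w).filter fun y => G.Adj u y).card = ((cellOf I₀.1.1 I₀.1.2 w).filter fun y => G.Adj u' y).card)
    {I : (cgProcess G).Inst} {X : Finset V} {lam : V → ℕ}
    (h : CertifiedLabels.Reach (cgProcess G) (cgSel (V := V)) (hgt G cgSel) I₀ I X lam) :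
    AdmB (4 * I₀.1.1.card + Nat.log 2 I₀.1.1.card) X lam :=
  admB_of_budgetBoundIn (reach_budgetBoundIn hI₀ h)

/-- **The root group outputs a good value** — any valuation, any decoding right on the solution subtree, admissibility at the window
budget `AdmB (4|I₀.block| + ⌊log₂|I₀.block|⌋)`, value range `|V|`, equitable start. -/
theorem cg_root_good_dec_admB_card {Val : Type*} [DecidableEq Val] (Vl : CertifiedLabels.Valuation (cgProcess G) Val)
    (hI₀ : ∀ u ∈ I₀.1.1, ∀ u' ∈ I₀.1.1, I₀.1.2 u = I₀.1.2 u' → ∀ w ∈ I₀.1.1,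
      ((cellOf I₀.1.1 I₀.1.2 w).filter fun y => G.Adj u y).card = ((cellOf I₀.1.1 I₀.1.2 w).filter fun y => G.Adj u' y).card)
    (dec : CertifiedLabels.Label V → Option (CGInst V))
    (hdec : ∀ (I : CGInst V) X lam, CertifiedLabels.Reach (cgProcess G) (cgSel (V := V)) (hgt G cgSel) I₀ I X lam → dec ⟨I.1.1, X, lam⟩ = some I) :
    ∃ v : Val, CertifiedLabels.val (cgProcess G) Vl dec (fun L => AdmB (4 * I₀.1.1.card + Nat.log 2 I₀.1.1.card) L.X L.lam)
      (Fintype.card V) ⟨I₀.1.1, ∅, fun _ => 0⟩ = some v ∧ Vl.Good I₀ v := by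
  have hne := cg_val_ne_none_of_reach_dec Vl dec hdec (fun L => AdmB (4 * I₀.1.1.card + Nat.log 2 I₀.1.1.card) L.X L.lam)
    (fun I X lam h => admB_of_reach_card hI₀ h) I₀ ∅ (fun _ => 0) CertifiedLabels.Reach.root
  obtain ⟨v, hv⟩ := Option.ne_none_iff_exists'.1 hne
  refine ⟨v, hv, ?_⟩
  obtain ⟨I, hI, hgood⟩ := CertifiedLabels.val_sound (cgProcess G) Vl dec _ _ _ v hv
  rw [hdec I₀ ∅ (fun _ => 0) CertifiedLabels.Reach.root] at hI
  cases hI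
  exact hgood

/-- **Completeness for any valuation with the generic replay decoding at the window budget**: the root group outputs a good value. -/
theorem cg_root_good_replay_admB_card {Val : Type*} [DecidableEq Val] (Vl : CertifiedLabels.Valuation (cgProcess G) Val)
    (hI₀ : ∀ u ∈ I₀.1.1, ∀ u' ∈ I₀.1.1, I₀.1.2 u = I₀.1.2 u' → ∀ w ∈ I₀.1.1,
      ((cellOf I₀.1.1 I₀.1.2 w).filter fun y => G.Adj u y).card = ((cellOf I₀.1.1 I₀.1.2 w).filter fun y => G.Adj u' y).card) :
    ∃ v : Val, CertifiedLabels.val (cgProcess G) Vl (fun L => CertifiedLabels.replay (cgProcess G) L I₀ ∅)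
      (fun L => AdmB (4 * I₀.1.1.card + Nat.log 2 I₀.1.1.card) L.X L.lam) (Fintype.card V) ⟨I₀.1.1, ∅, fun _ => 0⟩ = some v ∧
      Vl.Good I₀ v :=
  cg_root_good_dec_admB_card Vl hI₀ _ fun _ _ _ h => cg_replay_reach h

/-- The same from a block `W` with the refinement of a start colouring `λ₀` (process on `Fin m`, `W` the window, `λ₀` the signature
ranks): admissibility `AdmB (4|W| + ⌊log₂|W|⌋)`. -/
theorem cg_root_good_replay_admB_card_refineIn {Val : Type*} [DecidableEq Val] (Vl : CertifiedLabels.Valuation (cgProcess G) Val)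
    {W : Finset V} (hW : W.Nonempty) (lam₀ : V → ℕ) :
    ∃ v : Val, CertifiedLabels.val (cgProcess G) Vl (fun L => CertifiedLabels.replay (cgProcess G) L ⟨(W, refineIn G W lam₀), hW⟩ ∅)
      (fun L => AdmB (4 * W.card + Nat.log 2 W.card) L.X L.lam) (Fintype.card V) ⟨W, ∅, fun _ => 0⟩ = some v ∧
      Vl.Good ⟨(W, refineIn G W lam₀), hW⟩ v :=
  cg_root_good_replay_admB_card (I₀ := ⟨(W, refineIn G W lam₀), hW⟩) Vl
    (fun _ hu _ hu' huu' _ hw => equitableIn_refineIn W lam₀ hu hu' huu' hw)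

/-- Along the solution subtree the values are admissible at the window budget AND every group is valued — any valuation, generic replay
decoding (the shape the compiler's per-group semantics consumes). -/
theorem cg_val_ne_none_of_reach_replay_admB_card {Val : Type*} [DecidableEq Val] (Vl : CertifiedLabels.Valuation (cgProcess G) Val)
    (hI₀ : ∀ u ∈ I₀.1.1, ∀ u' ∈ I₀.1.1, I₀.1.2 u = I₀.1.2 u' → ∀ w ∈ I₀.1.1,
      ((cellOf I₀.1.1 I₀.1.2 w).filter fun y => G.Adj u y).card = ((cellOf I₀.1.1 I₀.1.2 w).filter fun y => G.Adj u' y).card)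
    {I : (cgProcess G).Inst} {X : Finset V} {lam : V → ℕ}
    (h : CertifiedLabels.Reach (cgProcess G) (cgSel (V := V)) (hgt G cgSel) I₀ I X lam) :
    CertifiedLabels.val (cgProcess G) Vl (fun L => CertifiedLabels.replay (cgProcess G) L I₀ ∅)
      (fun L => AdmB (4 * I₀.1.1.card + Nat.log 2 I₀.1.1.card) L.X L.lam) (Fintype.card V) ⟨I.1.1, X, lam⟩ ≠ none :=
  cg_val_ne_none_of_reach_dec Vl _ (fun _ _ _ h => cg_replay_reach h) _ (fun _ _ _ h => admB_of_reach_card hI₀ h) _ X lam h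

/-- **Labels of the solution subtree live inside the start block**: `X ⊆ I₀.block` and the block `⊆ I₀.block` (so a compiler may index
its label groups by `U, X ⊆ W`). -/
theorem reach_subset_block
    {I : (cgProcess G).Inst} {X : Finset V} {lam : V → ℕ}
    (h : CertifiedLabels.Reach (cgProcess G) (cgSel (V := V)) (hgt G cgSel) I₀ I X lam) : I.1.1 ⊆ I₀.1.1 ∧ X ⊆ I₀.1.1 := by
  induction h with
  | root => exact ⟨Subset.rfl, empty_subset _⟩
  | @part I X lam ps J hR hs hJ ih =>
    change CGInst V at I J
    refine ⟨?_, ih.2⟩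
    obtain ⟨-, rfl⟩ := cgStep_eq_andNode_iff.1 hs
    obtain ⟨-, hK⟩ := mem_cgParts_iff.1 hJ
    obtain ⟨w, -, hKw⟩ := mem_image.1 hK
    rw [← hKw]
    exact (swReach_subset _ _ w).trans ih.1
  | @child I X lam A ch hR hs ih =>
    change CGInst V at I
    have hx : cgSel I ∈ A := cgSel_mem I _ _ hs
    obtain ⟨-, -, rfl, rfl⟩ := cgStep_eq_orNode_iff.1 hs
    exact ⟨ih.1, insert_subset (ih.1 (smallestCell_subset _ _ hx)) ih.2⟩

end BranchSum

end Summit.PneNP.PneNP.Theorems
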